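import Literature.IUT.HodgeTheaters.TemperedCoveringsCor23iiiOfSpecialFibreHPrimeAdmissibleKernel
import Literature.IUT.HodgeTheaters.StableCurveTemperedDataOfSpecialFibreCuspedPiDataNV
import Literature.AnabelianGeometry.SemiGraphs.TemperedSpecialFibreTowerPiDataQuotientWitness
import Literature.AnabelianGeometry.SemiGraphs.PSCCoveringMapAlongProofs
import Literature.AnabelianGeometry.SemiGraphs.ProSigmaCompletionMaxQuotient
import Literature.AnabelianGeometry.SemiGraphs.ProSigmaCompletionSlim
import Literature.AnabelianGeometry.SemiGraphs.ProSigmaCompletionTransport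
import Literature.AnabelianGeometry.AbsoluteAnabelian.AbsTopIDef21GFGQuotientExistence
import Literature.AnabelianGeometry.AbsoluteAnabelian.GaloisSubextensionProofs
import Literature.GroupTheory.ProfiniteSubquotients
import HarnessLib

/-!
# JOINT NON-VACUITY of the (H′)-route binders of [IUTchI] Cor. 2.3 (iii)/(iv) — `PiData` with a PROPER base admissible
# quotient, a cusp, `ActGraphInduces`, (x) «`Δ̂_X` = profinite completion of `F₂`», `Ker(S.admissible) ≠ 1` — at ONE datum

S. Mochizuki, *Inter-universal Teichmüller theory I*, kurims manuscript (May 2020), §2, Cor. 2.3 (iii)/(iv) p. 47, proof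
pp. 48–49 [cite: Mochizuki2012, Cor 2.3(iii)(iv) pp.47-49] (D-0012 claim key; nothing of the series is asserted here);
Mochizuki, *Semi-graphs of anabelioids*, Publ. RIMS **42** (2006), Ex. 3.10 pp. 43–45 ("the natural quotient
`Δ ↠ π₁^temp(𝒢) ≅ π₁^temp(𝒢^c)`"), §6 p. 71 [cite: MochizukiSemiAnbd2006, Ex 3.10 pp.43-45].

PROOF-ONLY non-vacuity file (abc-iut cell; seat abc-iut-w4-d052 gen 7; L5-lead RULINGS #115 (1) row
«NV-PROPER-ADMISSIBLE-PIDATA-WITNESS» = TOKEN STANDARD (b) for the `_primes` headlines of IUTchI:Cor2.3(iii)/(iv),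
`cor23iii_/cor23iv_/cor23_i_to_iv_…_of_hPrime_of_admissibleKer_ne_bot_primes` — abc-iut-w4-d052 p491651 ∘ abc-iut-w4-d058
p491060/p492597/p493071; no definition, no instance, no new `Prop` fact).

* `OfSpecialFibre.freeGroupTwo_nonabelian`, `OfSpecialFibre.exists_normal_sigmaThree_index_ne_top` — `F₂` is nonabelian;
  `Ker(F₂ ↠ ℤ/3)` is normal of `{3}`-integer index and proper;
* `not_isProSigma_three_freeProfiniteTwo` — `F̂₂` is not pro-`3` (`F̂₂ ↠ ℤ/2`, open kernel of index `2`);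
* **`exists_piData_cusp_properAdmissible_freeProfinite`** — for EVERY prime `p`, all label data `Σ ⊆ Σ̂`, `p ∉ Σ` and
  every `cuspMeetsH`: a §6 datum `X : TemperedCurve p` (abc-iut-f-193's cusped free-profinite witness:
  `Π^temp := G_{ℚ_p} × F̂₂`, `K := ℚ_p`, ONE closed point, a CUSP, `Δ^temp ≅ F̂₂`), special-fibre data `S` whose BASE fibre is
  the one-vertex graph on the MAXIMAL PRO-`3` QUOTIENT `Q` of `Δ^temp` (abc-iut-L3-t4's presentation
  `PSCDatum.exists_isMaxProSigmaQuotient`; `S.admissible := Δ^temp ↠ Q`, kernel characteristic hence normal in `Π^temp` by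
  `GFGSurfaceModel.map_subtype_normal_of_isMaxProSigmaQuotient`; `Q` slim as the pro-`3` completion of `F₂`
  (`comp_isMaxProSigmaQuotient` + `IsProSigmaCompletion.isSlimGroup`), infinite (slim and non-trivial), second countable
  (open quotient)), the tower of characteristic open cores with one-vertex fibres, and `P : PiData X d S T`
  (`PiData.nonempty_of_charLevels_of_quotient`) SUCH THAT, JOINTLY: `⊤ ∈ S.chart.decompSubgroups P.H`, `X` has a cusp,
  **`P.ActGraphInduces`**, **`Ker(S.admissible) ≠ 1`** (else `F̂₂ ≅ Δ^temp ≅ Q` would be pro-`3`), **(x)** an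
  `ι : F₂ → Δ̂_X` with `IsProSigmaCompletion {q | q.Prime} ι` (`F₂ → F̂₂ ≃ Δ^temp_X ≃ Δ̂_X`, abc-iut-L3-t2's
  `isProSigmaCompletion_toCompletion` transported), AND the (iii) headline
  `cor23iii_ofSpecialFibre_closureH_of_piData_of_mem_decompSubgroups_of_hPrime_of_admissibleKer_ne_bot_primes` FIRES there.

HONEST LIMITS: consistency evidence for OUR binders only — `Π^temp` is a direct product and profinite (a genuine `Π^tp_X` is
neither), one closed point, one-vertex fibres with trivial graph actions, and the base admissible quotient is the maximal
pro-`3` quotient of `F̂₂`, NOT the admissible quotient of a curve «[model: product `Π^temp`, one-vertex fibres, base admissible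
quotient `F̂₂ ↠` pro-`3` completion]»; nothing of the papers is asserted; typed ≠ inhabited ≠ discharged; no side is taken
on [IUTchIII] Cor. 3.12 and nothing here asserts that abc is proved or refuted.
-/

noncomputable section

namespace Literature.IUT.HodgeTheaters

open _root_.Topology
open scoped Pointwise
open Literature.AlgebraicGeometry.Frobenioids (IsSlimGroup)
open Literature.AnabelianGeometry.SemiGraphs
open Literature.AnabelianGeometry.SemiGraphs.SemiGraphOfAnabelioids (IsProSigmaCompletion)
open Literature.AnabelianGeometry.AbsoluteAnabelian (IsTopologicallyFinitelyGenerated)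
open Literature.AnabelianGeometry.Anabelioids (IsSigmaInteger)

namespace StableCurveTemperedData

namespace OfSpecialFibre

/-! ### 1. The free group on two generators is nonabelian; an index-`3` normal subgroup -/

/-- `F₂` is nonabelian: the two free generators do not commute (they map to non-commuting transpositions of
`S₃`). [folklore] -/
private theorem freeGroupTwo_nonabelian : ∃ x y : FreeGroup (Fin 2), x * y ≠ y * x := by
  refine ⟨FreeGroup.of 0, FreeGroup.of 1, fun h => ?_⟩
  let f : Fin 2 → Equiv.Perm (Fin 3) := fun i => if i = 0 then Equiv.swap 0 1 else Equiv.swap 1 2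
  have h' := congrArg (FreeGroup.lift f) h
  simp only [map_mul, FreeGroup.lift_apply_of, f] at h'
  exact absurd h' (by decide)

/-- An index-`3` normal subgroup of `F₂` (the kernel of `F₂ ↠ ℤ/3`, both generators `↦ 1`): a normal subgroup of
`{3}`-integer index which is not everything. [folklore] -/
private theorem exists_normal_sigmaThree_index_ne_top :
    ∃ N : Subgroup (FreeGroup (Fin 2)), N.Normal ∧ IsSigmaInteger {3} N.index ∧ N ≠ ⊤ := by
  let ψ : FreeGroup (Fin 2) →* Multiplicative (ZMod 3) := FreeGroup.lift fun _ => Multiplicative.ofAdd 1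
  have hψ : Function.Surjective ψ := by
    intro y
    refine ⟨FreeGroup.of 0 ^ (Multiplicative.toAdd y).val, ?_⟩
    rw [map_pow]
    have h0 : ψ (FreeGroup.of 0) = Multiplicative.ofAdd 1 := by simp only [ψ, FreeGroup.lift_apply_of]
    rw [h0, ← ofAdd_nsmul, nsmul_eq_mul, mul_one, ZMod.natCast_zmod_val, ofAdd_toAdd]
  have hidx : ψ.ker.index = 3 := by
    rw [Subgroup.index_ker, MonoidHom.range_eq_top.mpr hψ, Subgroup.card_top, Nat.card_eq_fintype_card]
    rfl
  refine ⟨ψ.ker, inferInstance, ⟨by rw [hidx]; norm_num, fun q hq hdvd => ?_⟩, fun htop => ?_⟩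
  · rw [hidx] at hdvd
    exact (Nat.prime_dvd_prime_iff_eq hq Nat.prime_three).mp hdvd
  · have h1 : FreeGroup.of (0 : Fin 2) ∈ ψ.ker := by rw [htop]; exact Subgroup.mem_top _
    rw [MonoidHom.mem_ker] at h1
    simp only [ψ, FreeGroup.lift_apply_of] at h1
    exact absurd h1 (by decide)

end OfSpecialFibre

/-! ### 2. `F̂₂` is not pro-`3` -/

/-- **`F̂₂` is not a pro-`3` group**: `F₂ ↠ ℤ/2` extends to a continuous surjection `F̂₂ ↠ ℤ/2`, whose kernel is an open
normal subgroup of index `2 ∉ {3}`. [folklore] -/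
private theorem not_isProSigma_three_freeProfiniteTwo :
    ¬ IsProSigma ({3} : Set ℕ) (profiniteCompletion (FreeGroup (Fin 2))) := by
  intro h3
  let ψ : FreeGroup (Fin 2) →* Multiplicative (ZMod 2) := FreeGroup.lift fun _ => Multiplicative.ofAdd 1
  obtain ⟨φ, hφη, -, hφc⟩ := ProfiniteCompletion.exists_lift_of_finite ψ
  letI : TopologicalSpace (Multiplicative (ZMod 2)) := ⊥
  haveI : DiscreteTopology (Multiplicative (ZMod 2)) := ⟨rfl⟩
  have hcont : Continuous φ := hφc
  have hsurj : Function.Surjective φ := by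
    intro y
    refine ⟨toCompletion (FreeGroup (Fin 2)) (FreeGroup.of 0 ^ (Multiplicative.toAdd y).val), ?_⟩
    rw [hφη, map_pow]
    have h0 : ψ (FreeGroup.of 0) = Multiplicative.ofAdd 1 := by simp only [ψ, FreeGroup.lift_apply_of]
    rw [h0, ← ofAdd_nsmul, nsmul_eq_mul, mul_one, ZMod.natCast_zmod_val, ofAdd_toAdd]
  have hopen : IsOpen ((φ.ker : Subgroup (profiniteCompletion (FreeGroup (Fin 2)))) :
      Set (profiniteCompletion (FreeGroup (Fin 2)))) := by
    have : ((φ.ker : Subgroup _) : Set (profiniteCompletion (FreeGroup (Fin 2)))) = φ ⁻¹' {1} := by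
      ext x; exact MonoidHom.mem_ker
    rw [this]
    exact (isOpen_discrete _).preimage hcont
  let U : OpenNormalSubgroup (profiniteCompletion (FreeGroup (Fin 2))) := ⟨⟨φ.ker, hopen⟩, inferInstance⟩
  have hequiv : profiniteCompletion (FreeGroup (Fin 2)) ⧸ U.toSubgroup ≃* Multiplicative (ZMod 2) :=
    QuotientGroup.quotientKerEquivOfSurjective φ hsurj
  haveI : Finite (profiniteCompletion (FreeGroup (Fin 2)) ⧸ U.toSubgroup) := Finite.of_equiv _ hequiv.toEquiv.symm
  have hcard : Nat.card (profiniteCompletion (FreeGroup (Fin 2)) ⧸ U.toSubgroup) = 2 := by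
    rw [Nat.card_congr hequiv.toEquiv, Nat.card_eq_fintype_card]; rfl
  have h2 : (2 : ℕ) ∈ ({3} : Set ℕ) := h3.prime_mem U inferInstance 2 Nat.prime_two (by rw [hcard])
  exact absurd (Set.mem_singleton_iff.mp h2) (by norm_num)

/-! ### 3. The witness: `PiData` with base admissible quotient `Δ^temp ↠` its maximal pro-`3` quotient -/

section Witness

variable (p : ℕ) [Fact p.Prime]

/-- **JOINT NON-VACUITY of `{PiData P, a CUSP, hind : P.ActGraphInduces, (x) «Δ̂_X = profinite completion of the
nonabelian free group F₂», hK : Ker(S.admissible) ≠ 1, TpH ∈ decompSubgroups P.H}`** — the binder set of the (H′)-route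
headlines of [IUTchI] Cor. 2.3 (iii)/(iv) (`…_of_hPrime_of_admissibleKer_ne_bot_primes`, abc-iut-w4-d052 p491651 /
abc-iut-w4-d058 p493071) — at ONE explicit datum, for ALL label data `Σ ⊆ Σ̂`, `p ∉ Σ` and every `cuspMeetsH`:
`Π^temp := G_{ℚ_p} × F̂₂` with one cusp (abc-iut-f-193's cusped free-profinite §6 datum), tower levels the characteristic
open cores of `Δ^temp` with one-vertex fibres and admissible kernels `1`, and BASE fibre the one-vertex graph on the MAXIMAL
PRO-`3` QUOTIENT `Q` of `Δ^temp ≅ F̂₂`, `S.admissible := Δ^temp ↠ Q` — a PROPER quotient (`F̂₂` is not pro-`3`); and the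
(iii) headline FIRES there.  «[model: product `Π^temp`, one-vertex fibres, base admissible quotient `F̂₂ ↠` pro-`3`
completion]» [cite: MochizukiSemiAnbd2006, Ex 3.10 p.44] -/
theorem exists_piData_cusp_properAdmissible_freeProfinite
    (Sigma SigmaHat : Set ℕ) (hsub : Sigma ⊆ SigmaHat) (hne : Sigma.Nonempty)
    (hprime : ∀ q ∈ SigmaHat, q.Prime) (hp : p ∉ Sigma) :
    ∃ (X : TemperedCurve p) (d : X.GroupLevelData) (S : SpecialFibreData (X.toTemperedArithmeticGroup d))
      (h36 : S.Gc.Prop36Hypotheses) (T : SpecialFibreTower X.DeltaTemp) (P : SpecialFibreTower.PiData X d S T)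
      (TpH : Subgroup S.chart.G),
      TpH ∈ S.chart.decompSubgroups P.H ∧ (∃ x : X.Pt, X.IsCusp x) ∧ P.ActGraphInduces ∧
      S.admissible.toMonoidHom.ker ≠ ⊥ ∧
      ∀ cuspMeetsH : {x : X.Pt // X.IsCusp x} → Prop,
        ∃ ι : FreeGroup (Fin 2) →* (ofSpecialFibre X d S h36 Sigma SigmaHat hsub hne hprime hp TpH
            ((TpH.map (TemperedGraphGroupData.exists_completion_of_prop36 S.Gc h36
              S.chart).choose_spec.choose.toMonoidHom).topologicalClosure) (Subgroup.le_topologicalClosure _)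
            cuspMeetsH).DeltaHat,
          IsProSigmaCompletion {q : ℕ | q.Prime} ι ∧
          (ofSpecialFibre X d S h36 Sigma SigmaHat hsub hne hprime hp TpH
            ((TpH.map (TemperedGraphGroupData.exists_completion_of_prop36 S.Gc h36
              S.chart).choose_spec.choose.toMonoidHom).topologicalClosure) (Subgroup.le_topologicalClosure _)
            cuspMeetsH).Cor23iii := by
  classical
  haveI : IsGalois ℚ_[p] (AlgebraicClosure ℚ_[p]) := {}
  haveI : T2Space (GQp p) := krullTopology_t2
  haveI : SecondCountableTopology (profiniteCompletion (FreeGroup (Fin 2))) :=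
    secondCountableTopology_profiniteCompletion_freeGroup (Fin 2)
  haveI : Infinite (profiniteCompletion (FreeGroup (Fin 2))) := infinite_profiniteCompletion_freeGroupTwo
  -- abc-iut-f-193's cusped free-profinite §6 datum (its own special-fibre data and tower are discarded)
  have hW1 := SpecialFibreTower.PiData.exists_temperedCurve_freeProfiniteTwo_cusped p
  rcases hW1 with ⟨X, d, -, -, -, -, ⟨x₀, hx₀⟩, -, ⟨e, -, -, -, -, -⟩, -, -, -⟩
  -- topology of `Δ^temp ≅ F̂₂`
  haveI : SecondCountableTopology X.PiTemp := d.secondCountableTopology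
  haveI hΔcpt : CompactSpace X.DeltaTemp := e.toHomeomorph.compactSpace
  haveI hΔtd : TotallyDisconnectedSpace X.DeltaTemp :=
    ⟨isTotallyDisconnected_of_image e.symm.continuous.continuousOn e.symm.injective
      (isTotallyDisconnected_of_totallyDisconnectedSpace _)⟩
  haveI : SecondCountableTopology X.DeltaTemp := TopologicalSpace.Subtype.secondCountableTopology _
  have hinfΔ : Infinite X.DeltaTemp := Infinite.of_injective e e.injective
  have htfgΔ : IsTopologicallyFinitelyGenerated X.DeltaTemp :=
    isTopologicallyFinitelyGenerated_profiniteCompletion_freeGroupTwo.of_continuousMulEquiv e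
  -- the characteristic open cores of `Δ^temp` (abc-iut-w4-d053)
  have hW2 := charOpenCore_family_of_tfg (Γ := X.DeltaTemp) htfgΔ
  rcases hW2 with ⟨hanti, hlev, hcof⟩
  -- the maximal pro-`3` quotient `Q` of `Δ^temp` (abc-iut-L3-t4's presentation)
  have hW3 := PSCDatum.exists_isMaxProSigmaQuotient ({3} : Set ℕ) (P := X.DeltaTemp)
  rcases hW3 with ⟨K, hKn, hKc, hf⟩
  haveI := hKn
  haveI : IsClosed ((K : Subgroup X.DeltaTemp) : Set X.DeltaTemp) := hKc
  haveI : TotallyDisconnectedSpace (X.DeltaTemp ⧸ K) :=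
    Literature.GroupTheory.ProfiniteSubquotients.totallyDisconnectedSpace_quotient K hKc
  let π : X.DeltaTemp →ₜ* X.DeltaTemp ⧸ K := ⟨QuotientGroup.mk' K, QuotientGroup.continuous_mk⟩
  have hπ : Function.Surjective π := QuotientGroup.mk'_surjective K
  -- its kernel is characteristic, hence normal in `Π^temp`
  haveI : X.DeltaTemp.Normal := X.normal_deltaTemp
  have hKnPi : ((π.toMonoidHom.ker).map X.DeltaTemp.subtype).Normal :=
    Literature.AnabelianGeometry.AbsoluteAnabelian.GFGSurfaceModel.map_subtype_normal_of_isMaxProSigmaQuotient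
      X.DeltaTemp hf
  -- `F₂ → F̂₂ ≃ Δ^temp ↠ Q` is the pro-`3` completion of `F₂`; so `Q` is slim
  have hη : IsProSigmaCompletion {q : ℕ | q.Prime} (toCompletion (FreeGroup (Fin 2))) :=
    SemiGraphOfAnabelioids.IsProSigmaCompletion.isProSigmaCompletion_toCompletion (FreeGroup (Fin 2))
  have hηe : IsProSigmaCompletion {q : ℕ | q.Prime} (e.toMulEquiv.toMonoidHom.comp (toCompletion (FreeGroup (Fin 2)))) :=
    hη.comp_continuousMulEquiv e
  have h3 : IsProSigmaCompletion ({3} : Set ℕ)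
      (π.toMonoidHom.comp (e.toMulEquiv.toMonoidHom.comp (toCompletion (FreeGroup (Fin 2))))) :=
    SemiGraphOfAnabelioids.IsProSigmaCompletion.comp_isMaxProSigmaQuotient
      (fun q hq => by rw [Set.mem_singleton_iff.mp hq]; exact Nat.prime_three) hηe hf
  have hQslim : IsSlimGroup (X.DeltaTemp ⧸ K) :=
    SemiGraphOfAnabelioids.IsProSigmaCompletion.isSlimGroup OfSpecialFibre.freeGroupTwo_nonabelian h3
  -- `Q` is nontrivial (an index-`3` normal subgroup of `F₂` is pulled back from a proper open subgroup of `Q`) …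
  have hQnt : Nontrivial (X.DeltaTemp ⧸ K) := by
    have hW4 := OfSpecialFibre.exists_normal_sigmaThree_index_ne_top
    rcases hW4 with ⟨N, hNn, hNσ, hNtop⟩
    have hW5 := h3.comap_surj N hNn hNσ
    rcases hW5 with ⟨U, -, hU⟩
    by_contra hsub
    rw [not_nontrivial_iff_subsingleton] at hsub
    apply hNtop
    rw [← hU, eq_top_iff]
    intro g _
    rw [Subgroup.mem_comap]
    have h1 : (π.toMonoidHom.comp (e.toMulEquiv.toMonoidHom.comp (toCompletion (FreeGroup (Fin 2))))) g = 1 :=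
      Subsingleton.elim _ _
    rw [h1]
    exact U.one_mem
  -- … hence infinite (a finite slim Hausdorff group is trivial)
  haveI : Infinite (X.DeltaTemp ⧸ K) := by
    by_contra hfin
    rw [not_infinite_iff_finite] at hfin
    have hopen : IsOpen (((⊥ : Subgroup (X.DeltaTemp ⧸ K)) : Set (X.DeltaTemp ⧸ K))) := isOpen_discrete _
    have hc := hQslim.centralizer_eq_bot ⊥ hopen
    have htop : Subgroup.centralizer (((⊥ : Subgroup (X.DeltaTemp ⧸ K))) : Set (X.DeltaTemp ⧸ K)) = ⊤ := by
      rw [eq_top_iff]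
      intro g _
      rw [Subgroup.mem_centralizer_iff]
      intro h hh
      rw [Subgroup.mem_bot.mp hh, one_mul, mul_one]
    rw [htop] at hc
    have hW6 := hQnt
    rcases hW6 with ⟨a, b, hab⟩
    have ha : a ∈ (⊤ : Subgroup (X.DeltaTemp ⧸ K)) := Subgroup.mem_top a
    have hb : b ∈ (⊤ : Subgroup (X.DeltaTemp ⧸ K)) := Subgroup.mem_top b
    rw [hc] at ha hb
    exact hab (by rw [Subgroup.mem_bot.mp ha, Subgroup.mem_bot.mp hb])
  -- `K ≠ 1`: otherwise `F̂₂ ≅ Δ^temp ≅ Q` would be pro-`3`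
  have hKne : π.toMonoidHom.ker ≠ ⊥ := by
    intro hbot
    have hinj : Function.Injective π := (MonoidHom.ker_eq_bot_iff _).mp hbot
    let hmeo : X.DeltaTemp ≃ₜ (X.DeltaTemp ⧸ K) :=
      Continuous.homeoOfEquivCompactToT2 (f := Equiv.ofBijective π ⟨hinj, hπ⟩) π.continuous
    let ℓ : (X.DeltaTemp ⧸ K) ≃ₜ* X.DeltaTemp :=
      { (MulEquiv.ofBijective π.toMonoidHom ⟨hinj, hπ⟩).symm with
        continuous_toFun := hmeo.symm.continuous
        continuous_invFun := hmeo.continuous }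
    have hΔ3 : IsProSigma ({3} : Set ℕ) X.DeltaTemp :=
      isProSigma_of_surjective hf.proSigma ℓ.toMulEquiv.toMonoidHom ℓ.continuous ℓ.surjective
    have hF3 : IsProSigma ({3} : Set ℕ) (profiniteCompletion (FreeGroup (Fin 2))) :=
      isProSigma_of_surjective hΔ3 e.symm.toMulEquiv.toMonoidHom e.symm.continuous e.symm.surjective
    exact not_isProSigma_three_freeProfiniteTwo hF3
  -- the builder: `PiData` over the quotient base, with `ActGraphInduces` and `⊤ ∈ decompSubgroups ℍ`
  have hW7 := SpecialFibreTower.PiData.nonempty_of_charLevels_of_quotient X d hΔcpt hΔtd hinfΔ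
      (charOpenCore X.DeltaTemp)
      hanti (fun i => (hlev i).1) (fun i φ => (hlev i).2.2.2 φ.toMulEquiv φ.continuous φ.symm.continuous)
      (fun i => (hlev i).2.1) (fun i => (hlev i).2.2.1) (fun U hU _ hUf => hcof U hU hUf) (X.DeltaTemp ⧸ K)
      hQslim π hπ hKnPi
  rcases hW7 with ⟨S, T, -, -, hker, h36, -, P, hind, hTpH⟩
  have hK : S.admissible.toMonoidHom.ker ≠ ⊥ := hker hKne
  -- (x) at the datum: `F₂ → F̂₂ ≃ Δ^temp_X ≃ Δ̂_X = Ker(Π̂_X → G_K)`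
  have hW8 := X.nonempty_continuousMulEquiv_deltaHat_of_compactSpace_deltaTemp
  rcases hW8 with ⟨e₂⟩
  have heq : X.DeltaHat = (OfSpecialFibre.augHatGK X).ker := (OfSpecialFibre.ker_augHatGK_eq_deltaHat X d).symm
  let e₃ : X.DeltaHat ≃ₜ* (OfSpecialFibre.augHatGK X).ker :=
    { MulEquiv.subgroupCongr heq with
      continuous_toFun := (continuous_subtype_val).subtype_mk _
      continuous_invFun := (continuous_subtype_val).subtype_mk _ }
  refine ⟨X, d, S, h36, T, P, ⊤, hTpH, ⟨x₀, hx₀⟩, hind, hK, fun cuspMeetsH => ?_⟩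
  let ι : FreeGroup (Fin 2) →* (OfSpecialFibre.augHatGK X).ker :=
    (e₃.toMulEquiv.toMonoidHom).comp ((e₂.toMulEquiv.toMonoidHom).comp
      ((e.toMulEquiv.toMonoidHom).comp (toCompletion (FreeGroup (Fin 2)))))
  have hι : IsProSigmaCompletion {q : ℕ | q.Prime} ι :=
    ((hη.comp_continuousMulEquiv e).comp_continuousMulEquiv e₂).comp_continuousMulEquiv e₃
  refine ⟨ι, hι, ?_⟩
  exact cor23iii_ofSpecialFibre_closureH_of_piData_of_mem_decompSubgroups_of_hPrime_of_admissibleKer_ne_bot_primes X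
    d S h36 Sigma SigmaHat hsub hne hprime hp ⊤ cuspMeetsH T P hTpH hind OfSpecialFibre.freeGroupTwo_nonabelian hι hK

end Witness

end StableCurveTemperedData

end Literature.IUT.HodgeTheaters

end
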